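import Summits.Ventures.CertifiedArithmetic.LowPrec.GemmThetaE3M2Defs

/-!
# The θ-certificate of E3M2²→bfloat16: kernel check of the states with index in `[960, 1056)`

HONEST FRAMING (venture CertifiedArithmetic / cell `pub-lowprec`, seat gemm, gen 7): certified error
envelopes and provably optimal rounding/accumulation schemes for low-precision formats under stated
cost models; every table by two implementations; no hardware or vendor claims.

Part 11 of 27 of the kernel check of the Boolean certificate of `GemmThetaE3M2Defs.lean`
(paper `gemm.tex` §Regimes Prop. Θ(i), configuration E3M2·E3M2 → `bfloat16`, sequential, RNE): every
edge from the states with index `960 ≤ i < 1056` (both signs, all 291 letters, with the pair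
checks after free moves) passes `edgeOK`, by `decide +kernel` in chunks of 24 indices (each chunk
≈ 13,968 edges).  Split into files only to keep each file's kernel time near three minutes;
`GemmThetaE3M2.lean` assembles the parts.  See the Defs file for the meaning of the check.
-/

namespace Literature.ComputerArithmetic.FloatingPoint

namespace MiniFloat

namespace ThetaE3M2

/-- Every edge from the states with index in `[960, 984)` (both signs, all 291 letters) passes
`edgeOK`. [cell certificate, kernel-checked] -/
theorem edges_ok_960 : rowsOK 960 24 = true := by
  decide +kernel

/-- Every edge from the states with index in `[984, 1008)` (both signs, all 291 letters) passes
`edgeOK`. [cell certificate, kernel-checked] -/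
theorem edges_ok_984 : rowsOK 984 24 = true := by
  decide +kernel

/-- Every edge from the states with index in `[1008, 1032)` (both signs, all 291 letters) passes
`edgeOK`. [cell certificate, kernel-checked] -/
theorem edges_ok_1008 : rowsOK 1008 24 = true := by
  decide +kernel

/-- Every edge from the states with index in `[1032, 1056)` (both signs, all 291 letters) passes
`edgeOK`. [cell certificate, kernel-checked] -/
theorem edges_ok_1032 : rowsOK 1032 24 = true := by
  decide +kernel

/-- PART 11: every edge from the states with index in `[960, 1056)` passes `edgeOK`.
[cell certificate, kernel-checked] -/
theorem part_11 : rowsOK 960 96 = true :=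
  rowsOK_append (l₁ := 24) (l₂ := 72) edges_ok_960 <|
  rowsOK_append (l₁ := 24) (l₂ := 48) edges_ok_984 <|
  rowsOK_append (l₁ := 24) (l₂ := 24) edges_ok_1008 <|
  edges_ok_1032

end ThetaE3M2

end MiniFloat

end Literature.ComputerArithmetic.FloatingPoint
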